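import Literature.Computability.Cryptography.QuantumTuringMachineHeadCentredEntries
import Mathlib.LinearAlgebra.Matrix.Permutation
import HarnessLib

/-!
# Head-centred gates: the cyclic shift as a word of controlled swaps, and one gate format for every machine

Third file of the head-centred simulation of quantum Turing machines in the tree's model
(`QuantumTuringMachineHeadCentred.lean`: `hcStep = U_E · U_S · U_W`, `hcUnitary`;
`QuantumTuringMachineHeadCentredEntries.lean`: polynomial-time computable entries). It prepares the
passage from the three ABSTRACT factors to a FIXED, machine-dependent but input-length-independent,
finite list of gate formats, as the circuit side of `BQPQTM ⊆ BQP` requires (Nishimura–Ozawa 2002,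
proof of Thm. 4.3: the step of the simulating circuit is `K₂ ∘ K₁` with `G₁` "decomposable by `O(1)`
gates" and `G₂` "decomposable by `O(2t+1)` gates"):

* `permMat σ = Matrix.permMatrixHom σ` (Mathlib's permutation matrices, `|b⟩ ↦ |σ b⟩` convention),
  `permMat_mulVec_single`, `permMat_reverse_prod` — permutation gates;
* **`prodSwaps_eq_add_one`** — the cycle `z ↦ z + 1` of `ZMod N` is the word `τ₀ τ₁ ⋯ τ_{N-2}` of
  adjacent transpositions; hence (`winPerm`, `rightWord`, `leftWord`, **`shiftEquiv_eq_mul`**,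
  **`uS_eq_prod`**) the controlled cyclic shift `U_S` of the window is the operator of `2(N - 1)`
  controlled swaps of adjacent cells (fixed arity: direction bit + two cells);
* **`wMat`, `eMat`, `hcUnitary_eq_factor`** — one local step gate and one erasure gate for EVERY
  machine (`U_W`, `U_E` over tape alphabets with two symbols; `A ⊗ 1` and `1` over one-symbol
  alphabets, where `U_S = 1`), with `hcUnitary = (eMat placed) · U_S · (wMat placed)` in all cases,
  unitary for well-formed machines (`wMat_mem_unitaryGroup`, `eMat_mem_unitaryGroup`) and with
  polynomial-time computable entries when the amplitudes are (`wMat_polyTime`, `eMat_polyTime`).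

Everything is proved; no named facts.

## References

* H. Nishimura, M. Ozawa, Theoret. Comput. Sci. 276 (2002) 147–181 = arXiv:quant-ph/9906095
  [NishimuraOzawa2002], Thm. 4.3 and its proof (gates `G₁`, `G₂`; sizes `O(1)`, `O(2t+1)`).
* E. Bernstein, U. Vazirani, SIAM J. Comput. 26 (1997) 1411–1473 [BernsteinVazirani1997SICOMP],
  Lemma 5.5.
-/

noncomputable section

namespace Literature.Computability.Cryptography

open Turing Matrix
open scoped BigOperators ComplexConjugate

namespace QTM

/-! ### Permutation matrices -/

section perm

variable {X : Type*} [Fintype X] [DecidableEq X]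

/-- The permutation matrix of a permutation `σ` of a finite basis, `|b⟩ ↦ |σ b⟩` (entry `(a, b)` is
`[σ b = a]`): Mathlib's `Equiv.Perm.permMatrix` of `σ⁻¹`, i.e. `Matrix.permMatrixHom σ` (Mathlib's
`σ.permMatrix` is the matrix of `v ↦ v ∘ σ`, the inverse convention). [folklore] -/
abbrev permMat (σ : Equiv.Perm X) : Matrix X X ℂ := (σ⁻¹).permMatrix ℂ

omit [Fintype X] in
/-- Entries of a permutation matrix: `[σ b = a]`. [folklore] -/
theorem permMat_apply (σ : Equiv.Perm X) (a b : X) : permMat σ a b = if σ b = a then 1 else 0 := by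
  rw [permMat, Equiv.Perm.permMatrix, PEquiv.toMatrix_apply, Equiv.toPEquiv_apply]
  have : (b ∈ some (σ⁻¹ a)) ↔ (σ b = a) := by
    rw [Option.mem_def, Option.some.injEq, Equiv.Perm.inv_def, Equiv.symm_apply_eq]
    exact eq_comm
  simp only [this]

/-- A permutation matrix permutes amplitudes: `(P_σ v)(a) = v(σ⁻¹ a)` (`Matrix.permMatrix_mulVec`). [folklore] -/
theorem permMat_mulVec (σ : Equiv.Perm X) (v : X → ℂ) : permMat σ *ᵥ v = fun a => v (σ.symm a) := by
  rw [permMat, Matrix.permMatrix_mulVec]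
  rfl

/-- A permutation matrix maps basis vectors to basis vectors: `P_σ |b⟩ = |σ b⟩`. [folklore] -/
theorem permMat_mulVec_single (σ : Equiv.Perm X) (b : X) :
    permMat σ *ᵥ Pi.single b (1 : ℂ) = Pi.single (σ b) 1 := by
  rw [permMat_mulVec]
  ext a
  simp only [Pi.single_apply, Equiv.symm_apply_eq]

/-- `P_{στ} = P_σ P_τ` (`Matrix.permMatrixHom` is a monoid homomorphism). [folklore] -/
theorem permMat_mul (σ τ : Equiv.Perm X) : permMat (σ * τ) = permMat σ * permMat τ := by
  rw [permMat, permMat, permMat, _root_.mul_inv_rev, Matrix.permMatrix_mul]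

omit [Fintype X] in
/-- `P_1 = 1` (`Matrix.permMatrix_one`). [folklore] -/
theorem permMat_one : permMat (1 : Equiv.Perm X) = 1 := by
  rw [permMat, inv_one, Matrix.permMatrix_one]

omit [Fintype X] in
/-- `P_σᴴ = P_{σ⁻¹}` (`Matrix.conjTranspose_permMatrix`). [folklore] -/
theorem permMat_conjTranspose (σ : Equiv.Perm X) : (permMat σ)ᴴ = permMat σ⁻¹ := by
  rw [permMat, permMat, Matrix.conjTranspose_permMatrix]

/-- Permutation matrices are unitary. [folklore] -/
theorem permMat_mem_unitaryGroup (σ : Equiv.Perm X) : permMat σ ∈ Matrix.unitaryGroup X ℂ := by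
  rw [Matrix.mem_unitaryGroup_iff, star_eq_conjTranspose, permMat_conjTranspose, ← permMat_mul,
    mul_inv_cancel, permMat_one]

/-- The operator of a gate list of permutation gates (head applied first) is the permutation matrix of the composite permutation. [folklore] -/
theorem permMat_reverse_prod (l : List (Equiv.Perm X)) :
    (l.map permMat).reverse.prod = permMat l.reverse.prod := by
  induction l with
  | nil => simp [permMat_one]
  | cons σ l ih =>
    rw [List.map_cons, List.reverse_cons, List.prod_append, ih, List.reverse_cons, List.prod_append,
      List.prod_singleton, List.prod_singleton, permMat_mul]

end perm

/-! ### The cyclic shift as a word of adjacent transpositions -/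

section cycle

variable {N : ℕ} [NeZero N]

/-- The transposition of the window cells `j` and `j + 1` (indices in `ZMod N`). [folklore] -/
def cellSwap (N : ℕ) (j : ℕ) : Equiv.Perm (ZMod N) := Equiv.swap (j : ZMod N) ((j : ZMod N) + 1)

/-- The word `τ₀ τ₁ ⋯ τ_m` of adjacent transpositions `τ_j = (j, j+1)` (as a permutation; `τ_m` applied first). [folklore] -/
def prodSwaps (N : ℕ) (m : ℕ) : Equiv.Perm (ZMod N) := ((List.range (m + 1)).map (cellSwap N)).prod

omit [NeZero N] in
/-- `prodSwaps 0 = τ₀`. [folklore] -/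
theorem prodSwaps_zero : prodSwaps N 0 = cellSwap N 0 := by
  simp [prodSwaps]

omit [NeZero N] in
/-- `prodSwaps (m+1) = prodSwaps m · τ_{m+1}`. [folklore] -/
theorem prodSwaps_succ (m : ℕ) : prodSwaps N (m + 1) = prodSwaps N m * cellSwap N (m + 1) := by
  rw [prodSwaps, List.range_succ, List.map_append, List.prod_append, List.map_singleton,
    List.prod_singleton, prodSwaps]

omit [NeZero N] in
/-- Naturals below `N` are distinct modulo `N`. [folklore] -/
theorem natCast_zmod_inj {a b : ℕ} (ha : a < N) (hb : b < N) (h : (a : ZMod N) = b) : a = b := by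
  have := (ZMod.natCast_eq_natCast_iff' a b N).1 h
  rwa [Nat.mod_eq_of_lt ha, Nat.mod_eq_of_lt hb] at this

omit [NeZero N] in
/-- The word `τ₀ ⋯ τ_m` is the cycle `(0 1 ⋯ m+1)`: it sends `i ↦ i + 1` for `i ≤ m`, `m + 1 ↦ 0`, and
fixes everything else (for `m + 1 < N`). [folklore] -/
theorem prodSwaps_spec (m : ℕ) (hm : m + 1 < N) :
    (∀ i : ℕ, i ≤ m → prodSwaps N m (i : ZMod N) = (i : ZMod N) + 1) ∧
      prodSwaps N m ((m + 1 : ℕ) : ZMod N) = 0 ∧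
      (∀ z : ZMod N, (∀ i : ℕ, i ≤ m + 1 → z ≠ (i : ZMod N)) → prodSwaps N m z = z) := by
  induction m with
  | zero =>
    refine ⟨fun i hi => ?_, ?_, fun z hz => ?_⟩
    · obtain rfl : i = 0 := Nat.le_zero.1 hi
      simp [prodSwaps_zero, cellSwap]
    · rw [prodSwaps_zero, cellSwap, Nat.cast_zero, zero_add, Nat.cast_one, Equiv.swap_apply_right]
    · rw [prodSwaps_zero, cellSwap, Equiv.swap_apply_of_ne_of_ne]
      · exact_mod_cast hz 0 (by omega)
      · have := hz 1 le_rfl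
        rw [Nat.cast_zero, zero_add]
        exact_mod_cast this
  | succ m ih =>
    obtain ⟨h1, h2, h3⟩ := ih (by omega)
    have hne : ∀ {a b : ℕ}, a < N → b < N → a ≠ b → (a : ZMod N) ≠ (b : ZMod N) :=
      fun ha hb hab h => hab (natCast_zmod_inj ha hb h)
    have hcs : ∀ z : ZMod N, z ≠ ((m + 1 : ℕ) : ZMod N) → z ≠ ((m + 2 : ℕ) : ZMod N) →
        cellSwap N (m + 1) z = z := by
      intro z hz1 hz2
      rw [cellSwap, Equiv.swap_apply_of_ne_of_ne]
      · exact_mod_cast hz1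
      · push_cast at hz2 ⊢
        rwa [show (m : ZMod N) + 1 + 1 = m + 2 by ring]
    refine ⟨fun i hi => ?_, ?_, fun z hz => ?_⟩
    · rw [prodSwaps_succ, Equiv.Perm.mul_apply]
      rcases Nat.lt_or_ge i (m + 1) with hlt | hge
      · rw [hcs _ (hne (by omega) (by omega) (by omega)) (hne (by omega) (by omega) (by omega))]
        exact h1 i (by omega)
      · obtain rfl : i = m + 1 := le_antisymm hi hge
        rw [cellSwap, show ((m + 1 : ℕ) : ZMod N) = ((m + 1 : ℕ) : ZMod N) from rfl]
        rw [show (((m + 1 : ℕ) : ℕ) : ZMod N) = ((m + 1 : ℕ) : ZMod N) from rfl, Equiv.swap_apply_left]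
        rw [h3]
        · intro i hi'
          push_cast
          rw [show (m : ZMod N) + 1 + 1 = ((m + 2 : ℕ) : ZMod N) by push_cast; ring]
          exact hne (by omega) (by omega) (by omega)
    · rw [prodSwaps_succ, Equiv.Perm.mul_apply, cellSwap,
        show ((m + 1 + 1 : ℕ) : ZMod N) = ((m + 1 : ℕ) : ZMod N) + 1 by push_cast; ring,
        Equiv.swap_apply_right]
      exact h2
    · rw [prodSwaps_succ, Equiv.Perm.mul_apply, hcs z (hz (m + 1) (by omega)) ?_]
      · exact h3 z fun i hi => hz i (by omega)
      · have := hz (m + 2) le_rfl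
        exact_mod_cast this

/-- **The cyclic shift is a word of `N - 1` adjacent transpositions**: `τ₀ τ₁ ⋯ τ_{N-2} = (z ↦ z + 1)` on
`ZMod N` — the decomposition used to realise the head move of the head-centred register by `O(N)`
fixed-arity swap gates (Nishimura–Ozawa 2002, proof of Thm. 4.3: "`G₂` is decomposable by `O(2t+1)`
gates"). [folklore] -/
theorem prodSwaps_eq_add_one (hN : 2 ≤ N) (z : ZMod N) : prodSwaps N (N - 2) z = z + 1 := by
  obtain ⟨h1, h2, -⟩ := prodSwaps_spec (N := N) (N - 2) (by omega)
  have hz : z = ((z.val : ℕ) : ZMod N) := (ZMod.natCast_zmod_val z).symm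
  have hlt : z.val < N := ZMod.val_lt z
  rcases Nat.lt_or_ge z.val (N - 1) with h | h
  · rw [hz]
    exact h1 _ (by omega)
  · have hv : z.val = N - 2 + 1 := by omega
    rw [hz, hv, h2]
    have : ((N - 2 + 1 : ℕ) : ZMod N) + 1 = ((N : ℕ) : ZMod N) := by
      push_cast
      have : ((N - 2 : ℕ) : ZMod N) = (N : ZMod N) - 2 := by
        rw [Nat.cast_sub hN]
        push_cast
        ring
      rw [this]
      ring
    rw [this, ZMod.natCast_self]

omit [NeZero N] in
/-- The reversed word is the inverse permutation (transpositions are involutions). [folklore] -/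
theorem prodSwaps_reverse (m : ℕ) :
    ((List.range (m + 1)).map (cellSwap N)).reverse.prod = (prodSwaps N m)⁻¹ := by
  rw [prodSwaps, List.prod_inv_reverse, List.map_map]
  rfl

end cycle

/-! ### Window permutations of the head-centred register and the shift word -/

section window_perm

variable (M : QTM) (N : ℕ) [NeZero N]

/-- The permutation of the head-centred register that permutes the WINDOW by `σ` when the direction bit
equals `b` and does nothing otherwise (a controlled cell permutation). [folklore] -/
def winPerm (b : Bool) (σ : Equiv.Perm (ZMod N)) : Equiv.Perm (M.HC N) where
  toFun r := (r.1, if r.2.2.1 = b then r.2.1 ∘ σ else r.2.1, r.2.2.1, r.2.2.2)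
  invFun r := (r.1, if r.2.2.1 = b then r.2.1 ∘ σ.symm else r.2.1, r.2.2.1, r.2.2.2)
  left_inv := by
    rintro ⟨q, w, d, e⟩
    by_cases h : d = b
    · simp [h, Function.comp_assoc]
    · simp [h]
  right_inv := by
    rintro ⟨q, w, d, e⟩
    by_cases h : d = b
    · simp [h, Function.comp_assoc]
    · simp [h]

omit [NeZero N] in
/-- Action of a controlled window permutation (definitional). [folklore] -/
theorem winPerm_apply (b : Bool) (σ : Equiv.Perm (ZMod N)) (r : M.HC N) :
    M.winPerm N b σ r = (r.1, if r.2.2.1 = b then r.2.1 ∘ σ else r.2.1, r.2.2.1, r.2.2.2) := rfl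

omit [NeZero N] in
/-- Controlled window permutations compose contravariantly: `W_σ W_τ = W_{τσ}`. [folklore] -/
theorem winPerm_mul (b : Bool) (σ τ : Equiv.Perm (ZMod N)) :
    M.winPerm N b σ * M.winPerm N b τ = M.winPerm N b (τ * σ) := by
  ext1 r
  obtain ⟨q, w, d, e⟩ := r
  rw [Equiv.Perm.mul_apply, winPerm_apply, winPerm_apply, winPerm_apply]
  by_cases h : d = b
  · simp only [h, if_true, Prod.mk.injEq, true_and, and_true]
    rfl
  · simp [h]

omit [NeZero N] in
/-- The controlled window permutation of the identity is the identity. [folklore] -/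
theorem winPerm_one (b : Bool) : M.winPerm N b 1 = 1 := by
  ext1 r
  obtain ⟨q, w, d, e⟩ := r
  rw [winPerm_apply]
  simp

omit [NeZero N] in
/-- A gate list of controlled window permutations acts as the controlled window permutation of the product. [folklore] -/
theorem winPerm_reverse_prod (b : Bool) (l : List (Equiv.Perm (ZMod N))) :
    ((l.map (M.winPerm N b)).reverse).prod = M.winPerm N b l.prod := by
  induction l with
  | nil => simp [winPerm_one]
  | cons σ l ih =>
    rw [List.map_cons, List.reverse_cons, List.prod_append, ih, List.prod_singleton, winPerm_mul,
      List.prod_cons]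

/-- The gate word for the head moving RIGHT (direction bit `true`): controlled swaps of cells
`(0,1), (1,2), …, (N-2,N-1)` in this order, realising `w ↦ w ∘ (· + 1)`. [cite: NishimuraOzawa2002, Thm. 4.3 (proof, gate G₂)] -/
def rightWord : List (Equiv.Perm (M.HC N)) := (List.range (N - 1)).map fun j => M.winPerm N true (cellSwap N j)

/-- The gate word for the head moving LEFT (direction bit `false`): controlled swaps of cells
`(N-2,N-1), …, (1,2), (0,1)` in this order, realising `w ↦ w ∘ (· - 1)`. [cite: NishimuraOzawa2002, Thm. 4.3 (proof, gate G₂)] -/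
def leftWord : List (Equiv.Perm (M.HC N)) :=
  ((List.range (N - 1)).reverse).map fun j => M.winPerm N false (cellSwap N j)

/-- The right word acts as the controlled shift `w ↦ w ∘ (· + 1)` (`N ≥ 2`). [folklore] -/
theorem rightWord_reverse_prod (hN : 2 ≤ N) :
    (M.rightWord N).reverse.prod = M.winPerm N true (Equiv.addRight 1) := by
  rw [rightWord, show (List.range (N - 1)).map (fun j => M.winPerm N true (cellSwap N j)) =
    ((List.range (N - 2 + 1)).map (cellSwap N)).map (M.winPerm N true) by
      rw [List.map_map, show N - 2 + 1 = N - 1 by omega]; rfl]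
  rw [winPerm_reverse_prod, ← prodSwaps]
  congr 1
  ext z
  rw [prodSwaps_eq_add_one hN]
  rfl

/-- The left word acts as the controlled shift `w ↦ w ∘ (· - 1)` (`N ≥ 2`). [folklore] -/
theorem leftWord_reverse_prod (hN : 2 ≤ N) :
    (M.leftWord N).reverse.prod = M.winPerm N false (Equiv.addRight (-1 : ZMod N)) := by
  rw [leftWord, List.map_reverse, List.reverse_reverse]
  rw [show (List.range (N - 1)).map (fun j => M.winPerm N false (cellSwap N j)) =
    (((List.range (N - 2 + 1)).map (cellSwap N)).map (M.winPerm N false)) by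
      rw [List.map_map, show N - 2 + 1 = N - 1 by omega]; rfl]
  rw [← List.reverse_reverse (List.map (M.winPerm N false) _), ← List.map_reverse,
    winPerm_reverse_prod, prodSwaps_reverse]
  congr 1
  ext z
  rw [Equiv.Perm.inv_def, Equiv.symm_apply_eq, prodSwaps_eq_add_one hN]
  simp

/-- **The controlled cyclic shift `shiftEquiv` of the head-centred register is the composite of the left
word and the right word** (`N ≥ 2`). [cite: NishimuraOzawa2002, Thm. 4.3 (proof, gate G₂)] -/
theorem shiftEquiv_eq_mul (hN : 2 ≤ N) :
    M.shiftEquiv N = (M.leftWord N).reverse.prod * (M.rightWord N).reverse.prod := by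
  rw [leftWord_reverse_prod M N hN, rightWord_reverse_prod M N hN]
  ext1 r
  obtain ⟨q, w, d, e⟩ := r
  rw [shiftEquiv_apply, Equiv.Perm.mul_apply, winPerm_apply, winPerm_apply]
  cases d
  · simp only [Bool.false_eq_true, if_false, if_true, bshift, Prod.mk.injEq, true_and, and_true]
    funext i
    simp
  · simp only [if_true, Bool.true_eq_false, if_false, bshift, Prod.mk.injEq, true_and, and_true]
    rfl

/-- `U_S` is the permutation matrix of `shiftEquiv` (definitional). [folklore] -/
theorem uS_eq_permMat : M.uS N = permMat (M.shiftEquiv N) := by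
  ext a b
  rw [uS_apply, permMat_apply]

/-- **`U_S` as a product of `2(N-1)` controlled adjacent cell swaps** (the operators of `leftWord` and
`rightWord`). [cite: NishimuraOzawa2002, Thm. 4.3 (proof, gate G₂)] -/
theorem uS_eq_prod (hN : 2 ≤ N) :
    M.uS N = ((M.leftWord N).map permMat).reverse.prod * ((M.rightWord N).map permMat).reverse.prod := by
  rw [uS_eq_permMat, shiftEquiv_eq_mul M N hN, permMat_mul, permMat_reverse_prod, permMat_reverse_prod]

end window_perm

/-! ### The unified local gates and the factorisation of `hcUnitary` -/

section unified

variable (M : QTM)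

/-- The local step gate for one-symbol alphabets: the state-marginal unitary `A = δ_L + δ_R` on the state component of the local register. [folklore] -/
def uW₁ : Matrix M.Loc M.Loc ℂ := liftMat (Equiv.refl M.Loc) M.localSum

open Classical in
/-- **The local step gate of an arbitrary machine**: `U_W` (swap unitary of the local transition,
Nishimura–Ozawa's `G₁`) over alphabets with two symbols, `A ⊗ 1` over one-symbol alphabets — so that ONE
circuit shape serves every machine. [cite: NishimuraOzawa2002, Thm. 4.3 (proof, gate G₁)] -/
def wMat : Matrix M.Loc M.Loc ℂ := if Nontrivial M.Γ then M.uW else M.uW₁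

open Classical in
/-- **The erasure gate of an arbitrary machine**: `U_E` (Bernstein–Vazirani's change of basis) over
alphabets with two symbols, the identity over one-symbol alphabets. [cite: BernsteinVazirani1997SICOMP, Lemma 5.5] -/
def eMat : Matrix M.Er M.Er ℂ := if Nontrivial M.Γ then M.uE else 1

/-- Over two-symbol alphabets the local step gate is `U_W`. [folklore] -/
theorem wMat_of_nontrivial [Nontrivial M.Γ] : M.wMat = M.uW := by
  unfold wMat; rw [if_pos ‹_›]

/-- Over one-symbol alphabets the local step gate is `A ⊗ 1`. [folklore] -/
theorem wMat_of_subsingleton [Subsingleton M.Γ] : M.wMat = M.uW₁ := by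
  unfold wMat; rw [if_neg (not_nontrivial M.Γ)]

/-- Over two-symbol alphabets the erasure gate is `U_E`. [folklore] -/
theorem eMat_of_nontrivial [Nontrivial M.Γ] : M.eMat = M.uE := by
  unfold eMat; rw [if_pos ‹_›]

/-- Over one-symbol alphabets the erasure gate is the identity. [folklore] -/
theorem eMat_of_subsingleton [Subsingleton M.Γ] : M.eMat = 1 := by
  unfold eMat; rw [if_neg (not_nontrivial M.Γ)]

/-- The local step gate of a well-formed machine is unitary. [cite: NishimuraOzawa2002, Thm. 4.3] -/
theorem wMat_mem_unitaryGroup (hwf : M.IsWellFormed) : M.wMat ∈ Matrix.unitaryGroup M.Loc ℂ := by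
  rcases subsingleton_or_nontrivial M.Γ with hΓ | hΓ
  · rw [wMat_of_subsingleton]
    exact liftMat_mem_unitaryGroup _ (M.localSum_mem_unitaryGroup hwf)
  · rw [wMat_of_nontrivial]
    exact M.uW_mem_unitaryGroup hwf.isLocallyWellFormed

/-- The erasure gate of a well-formed machine is unitary. [cite: BernsteinVazirani1997SICOMP, Lemma 5.5] -/
theorem eMat_mem_unitaryGroup (hwf : M.IsWellFormed) : M.eMat ∈ Matrix.unitaryGroup M.Er ℂ := by
  rcases subsingleton_or_nontrivial M.Γ with hΓ | hΓ
  · rw [eMat_of_subsingleton]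
    exact Submonoid.one_mem _
  · rw [eMat_of_nontrivial]
    exact M.uE_mem_unitaryGroup hwf.isLocallyWellFormed

/-- The erasure gate is an involution. [folklore] -/
theorem eMat_mul_self (hwf : M.IsWellFormed) : M.eMat * M.eMat = 1 := by
  rcases subsingleton_or_nontrivial M.Γ with hΓ | hΓ
  · rw [eMat_of_subsingleton, Matrix.mul_one]
  · rw [eMat_of_nontrivial]
    exact M.uE_mul_self hwf.isLocallyWellFormed

variable (N : ℕ) [NeZero N]

omit [NeZero N] in
/-- Over one-symbol alphabets the window carries no information and the shift is the identity. [folklore] -/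
theorem shiftEquiv_eq_one [Subsingleton M.Γ] : M.shiftEquiv N = 1 := by
  ext1 r
  obtain ⟨q, w, d, e⟩ := r
  rw [shiftEquiv_apply, Equiv.Perm.one_apply]
  simp only [Prod.mk.injEq, true_and, and_true]
  exact Subsingleton.elim _ _

/-- Over one-symbol alphabets `U_S = 1`. [folklore] -/
theorem uS_eq_one [Subsingleton M.Γ] : M.uS N = 1 := by
  rw [uS_eq_permMat, shiftEquiv_eq_one, permMat_one]

/-- Over one-symbol alphabets the placed local step gate `(A ⊗ 1) ⊗ 1` is the one-symbol step operator `hcStep₁`. [folklore] -/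
theorem liftMat_splitW_uW₁ [Subsingleton M.Γ] : liftMat (M.splitW N) M.uW₁ = M.hcStep₁ N := by
  ext x y
  obtain ⟨xq, xw, xd, xe⟩ := x
  obtain ⟨yq, yw, yd, ye⟩ := y
  have hw : xw = yw := Subsingleton.elim _ _
  subst hw
  rw [hcStep₁, liftMat_apply, liftMat_apply, uW₁, liftMat_apply]
  simp only [splitW_apply_fst, splitW_apply_snd, Equiv.refl_apply, Prod.mk.injEq, true_and]
  by_cases h : xd = yd ∧ xe = ye <;> simp [h]

/-- **Factorisation of the head-centred step unitary of an ARBITRARY machine** into the three placed gates: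
`hcUnitary = (eMat on (state,d,e)) · U_S · (wMat on (state, cell 0, d, e))` — by definition over two-symbol
alphabets, and because `U_S = 1`, `eMat = 1` over one-symbol alphabets. [cite: NishimuraOzawa2002, Thm. 4.3 (proof)] -/
theorem hcUnitary_eq_factor :
    M.hcUnitary N = liftMat (M.splitE N) M.eMat * M.uS N * liftMat (M.splitW N) M.wMat := by
  rcases subsingleton_or_nontrivial M.Γ with hΓ | hΓ
  · rw [hcUnitary_of_subsingleton, eMat_of_subsingleton, wMat_of_subsingleton, liftMat_one, uS_eq_one,
      Matrix.one_mul, Matrix.one_mul, liftMat_splitW_uW₁]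
  · rw [hcUnitary_of_nontrivial, eMat_of_nontrivial, wMat_of_nontrivial]
    rfl

/-- Entries of the one-symbol local gate are entries of `A` or `0`. [folklore] -/
theorem uW₁_apply_mem {S : Set ℂ} (h0 : (0 : ℂ) ∈ S) (hA : ∀ q' q, M.localSum q' q ∈ S) (x y : M.Loc) :
    M.uW₁ x y ∈ S := by
  rw [uW₁, liftMat_apply]
  split_ifs
  exacts [hA _ _, h0]

/-- For a machine with polynomial-time computable amplitudes the local step gate has polynomial-time computable entries. [cite: NishimuraOzawa2002, §4] -/
theorem wMat_polyTime (h : M.amplitudes ⊆ polyTimeComputableComplex) (x y : M.Loc) :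
    M.wMat x y ∈ polyTimeComputableComplex := by
  rcases subsingleton_or_nontrivial M.Γ with hΓ | hΓ
  · rw [wMat_of_subsingleton]
    exact M.uW₁_apply_mem polyTimeComputableSubfield.zero_mem (M.localSum_polyTime h) x y
  · rw [wMat_of_nontrivial]
    exact M.uW_polyTime h x y

/-- For a machine with polynomial-time computable amplitudes the erasure gate has polynomial-time computable entries. [cite: NishimuraOzawa2002, §4] -/
theorem eMat_polyTime (h : M.amplitudes ⊆ polyTimeComputableComplex) (x y : M.Er) :
    M.eMat x y ∈ polyTimeComputableComplex := by
  rcases subsingleton_or_nontrivial M.Γ with hΓ | hΓ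
  · rw [eMat_of_subsingleton, one_apply]
    split_ifs
    exacts [polyTimeComputableSubfield.one_mem, polyTimeComputableSubfield.zero_mem]
  · rw [eMat_of_nontrivial]
    exact M.uE_polyTime h x y

/-- …and so does the inverse `wMatᴴ` of the local step gate. [folklore] -/
theorem wMat_conjTranspose_polyTime (h : M.amplitudes ⊆ polyTimeComputableComplex) (x y : M.Loc) :
    M.wMatᴴ x y ∈ polyTimeComputableComplex :=
  conj_mem_polyTimeComputableSubfield _ (M.wMat_polyTime h y x)

end unified

end QTM

end Literature.Computability.Cryptography

end
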